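import Summits.NavierStokesRegularity.FluidComputer.PalasekTowerBurgersNumberLevelZero
import Literature.Analysis.FluidPDE.StrainedGaussianVortexCore

/-!
# REGISTER v2.3′: the COMPACTION BUDGET of a strained Gaussian child core, by name (N-2′ exact)

Cell `ns-blowup`, seat `ns-blowup-ecbridge-8` (g4); evidence toward the readout side of the cruxes
19179 `EpisodeBaseG` (level `0 → 1`) / 19249 / 19250 of route `PalasekTowerBreakdown`; planner
STATUS l.3420 (N-2′: «the level-0→1 requirement is a COMPACTION BUDGET `∫s dt ≈ 4–6` cell strain-times
in a run-up ENDING AT `τ₁`») and l.3425 (ASK E8-a: «if the Lundgren clocks give the compaction budget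
in closed form, that is N-2′ made exact»). LABEL: MODEL-side register arithmetic over the Literature
theorems of `StrainedGaussianVortexCore` (p447006): a Gaussian seed `Γ H(s₀, ·)` put at time `0` into
the axisymmetric strain `γ` at viscosity `ν` stays Gaussian with core parameter
`δ(t)² = s₀e^{−γt} + (ν/γ)(1 − e^{−γt})` (`RadialEddy.strainedEddyVorticity_gaussian`), the carrying
Navier–Stokes flow being at each instant the strain plus THE BURGERS SWIRL OF STRAIN `ν/δ(t)²`
(`RadialEddy.strainedEddy_gaussian_eq`), and `δ² ≤ ρ·δ_B²` iff `γt ≥ log((s₀/δ_B² − 1)/(ρ − 1))`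
(`RadialEddy.strainedCoreRadiusSq_le_iff`).

WHAT THIS IS NOT: not NS about any registered flow — the strained Gaussian eddy is an exact
infinite-energy solution (linear strain field) and no registered stage; nothing is asserted about
`ReadoutFloors`, `AprioriCeiling` or any crux. MODEL identification (parts 1–3): «the level-1 child
core is a Gaussian tube of seed parameter `s₀` (core radius² in the convention `e^{−r²/4s}`) and
circulation `C · N₁^{β−2}`, compacting at `ν = 1` in the host strain `λ · A₀` during a run-up of
duration `t` ending at the readout instant».

## §1 The dictionary: a strained Gaussian child reads as a Burgers child with `λ_eff`

At `ν = 1` the strain read on the core is `1/δ(t)² = λ_eff(t) · A₀` with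
**`λ_eff = λ/(1 + (s₀λA₀ − 1)e^{−λA₀t})`** (`_effectiveStrainFactor`; `s₀λA₀ = (δ_s/δ_B)²` is the seed
in Burgers areas, `λA₀t` the run-up in host strain-times), and the flow IS `U_{λA₀} +
burgersVortexSwirl (λ_eff A₀) 1 (C N₁^{β−2})` (`_gaussianChild_eq`): every swirl readout of the
level-0 polytope (`PalasekTowerBurgersNumberLevelZero`: velocity floor / ceiling on the swirl, strain
floor by the child's own gradient on the axis) applies AT THE READOUT INSTANT with `λ ↦ λ_eff`
(`_gaussianChild_polytope_zero`: `13.46 < C√λ_eff < 25.12`, `0.33 < λ_eff`).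

## §2 The budget in register units

`λ_eff < λ` always (`_effectiveStrainFactor_lt`, fat seed), and `λ_eff ≥ λ/ρ` iff the run-up delivers
`λA₀t ≥ log((s₀λA₀ − 1)/(ρ − 1))` host strain-times (`_compaction_budget_iff`); the rigid window
`0 → 1` holds `61.72 < (τ₁ − τ₀)A₀ < 61.73` strain-times of `A₀` (ecbridge-6 g3), so a run-up
occupying the fraction `θ` of the window delivers `B = λθ(τ₁ − τ₀)A₀ ∈ (61.72λθ, 61.73λθ)`
(`_compaction_budget_window`). Consequence for the polytope (`_lambda_floor_seeded`): the axis
reading `λ_eff > 0.33` forces **`λ > 0.33·(1 + (s₀λA₀ − 1)e^{−λA₀t})`** — the host strain factor must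
exceed the level-0 floor by exactly the un-compacted excess of the seed.

References: P. G. Saffman, *Vortex Dynamics*, CUP 1992, §13.3 (29)–(31) [cite: Saffman1992, §13.3
eq. (31)]; S. Palasek, arXiv:2605.13827, §3 (3.2) [cite: Palasek2026ElementaryModel, §3 (3.2)].
-/

namespace Summit.NavierStokesRegularity.FluidComputer.PalasekTowerClayBridge

open Real
open Literature.Analysis.FluidPDE

/-! ## §1 The dictionary `λ ↦ λ_eff` -/

/-- Positivity of the core parameter of the level-`k` strained Gaussian child (`ν = 1`, host strain
`λA_k`, `t ≥ 0`). -/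
theorem palasekTowerBreakdown_coreRadiusSq_pos (R : TowerRates) (k : ℕ) {l s₀ t : ℝ} (hl : 0 < l)
    (hs₀ : 0 < s₀) (ht : 0 ≤ t) :
    0 < RadialEddy.strainedCoreRadiusSq (l * R.A k) 1 s₀ t :=
  RadialEddy.strainedCoreRadiusSq_pos (mul_pos hl (R.A_pos k)) one_pos hs₀ ht

/-- The denominator `1 + (s₀λA_k − 1)e^{−λA_k t}` of `λ_eff` is positive for `t ≥ 0` (it is at least
`min(1, s₀λA_k)`). -/
theorem palasekTowerBreakdown_effectiveStrainFactor_den_pos (R : TowerRates) (k : ℕ) {l s₀ t : ℝ}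
    (hl : 0 < l) (hs₀ : 0 < s₀) (ht : 0 ≤ t) :
    0 < 1 + (s₀ * (l * R.A k) - 1) * exp (-(l * R.A k * t)) := by
  have hγ : 0 < l * R.A k := mul_pos hl (R.A_pos k)
  have he := exp_pos (-(l * R.A k * t))
  have he1 : exp (-(l * R.A k * t)) ≤ 1 := by
    rw [exp_le_one_iff]; nlinarith
  have hr : 0 < s₀ * (l * R.A k) := mul_pos hs₀ hγ
  rcases le_or_gt 1 (s₀ * (l * R.A k)) with h | h
  · nlinarith
  · nlinarith

/-- **The effective strain factor**: at `ν = 1` the strain read on the strained Gaussian child core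
after a run-up of duration `t ≥ 0` in the host strain `λA_k` is `1/δ(t)² = λ_eff · A_k`,
`λ_eff = λ/(1 + (s₀λA_k − 1)e^{−λA_k t})`. -/
theorem palasekTowerBreakdown_effectiveStrainFactor (R : TowerRates) (k : ℕ) {l s₀ t : ℝ}
    (hl : 0 < l) (hs₀ : 0 < s₀) (ht : 0 ≤ t) :
    1 / RadialEddy.strainedCoreRadiusSq (l * R.A k) 1 s₀ t =
      l / (1 + (s₀ * (l * R.A k) - 1) * exp (-(l * R.A k * t))) * R.A k := by
  have hA := R.A_pos k
  have hγ : 0 < l * R.A k := mul_pos hl hA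
  have hδ := (palasekTowerBreakdown_coreRadiusSq_pos R k hl hs₀ ht).ne'
  have h := RadialEddy.effectiveStrain_eq hγ.ne' one_ne_zero s₀ t hδ
  rw [div_one] at h
  rw [h]
  have hden := (palasekTowerBreakdown_effectiveStrainFactor_den_pos R k hl hs₀ ht).ne'
  field_simp

/-- **The effective strain factor is positive.** -/
theorem palasekTowerBreakdown_effectiveStrainFactor_pos (R : TowerRates) (k : ℕ) {l s₀ t : ℝ}
    (hl : 0 < l) (hs₀ : 0 < s₀) (ht : 0 ≤ t) :
    0 < l / (1 + (s₀ * (l * R.A k) - 1) * exp (-(l * R.A k * t))) := by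
  exact div_pos hl (palasekTowerBreakdown_effectiveStrainFactor_den_pos R k hl hs₀ ht)

/-- **A fat seed reads below the host strain**: if `s₀λA_k > 1` (seed fatter than the Burgers core of
the host strain) then `λ_eff < λ` for every `t`. -/
theorem palasekTowerBreakdown_effectiveStrainFactor_lt (R : TowerRates) (k : ℕ) {l s₀ t : ℝ}
    (hl : 0 < l) (hfat : 1 < s₀ * (l * R.A k)) :
    l / (1 + (s₀ * (l * R.A k) - 1) * exp (-(l * R.A k * t))) < l := by
  have he := exp_pos (-(l * R.A k * t))
  have hden : 1 < 1 + (s₀ * (l * R.A k) - 1) * exp (-(l * R.A k * t)) := by nlinarith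
  exact div_lt_self hl hden

/-- **THE STRAINED GAUSSIAN CHILD IS A BURGERS CHILD WITH `λ_eff`**: for `λ, s₀ > 0`, `t > 0` and any
circulation constant `C`, MB's strained-eddy flow (2.69) of the Gaussian seed
`(C N_{k+1}^{β−2}) · H(s₀, ·)` in the host strain `λA_k` at `ν = 1` is, at time `t`, the axisymmetric
strain `λA_k` plus `burgersVortexSwirl (λ_eff A_k) 1 (C N_{k+1}^{β−2})`. -/
theorem palasekTowerBreakdown_gaussianChild_eq (R : TowerRates) (k : ℕ) {l s₀ t : ℝ} (C : ℝ)
    (hl : 0 < l) (hs₀ : 0 < s₀) (ht : 0 < t) (x : EuclideanSpace ℝ (Fin 3)) :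
    RadialEddy.strainedEddy (l * R.A k) (fun t => RadialEddy.vorticityToSwirl (RadialEddy.rayProfile
        (RadialEddy.strainedEddyVorticity (l * R.A k) 1
          (fun y => C * R.N (k + 1) ^ (R.β - 2) * Literature.Analysis.UnboundedOperators.heatKernel s₀ y) t))) t x =
      axisymmetricStrain (l * R.A k) x +
        burgersVortexSwirl (l / (1 + (s₀ * (l * R.A k) - 1) * exp (-(l * R.A k * t))) * R.A k) 1
          (C * R.N (k + 1) ^ (R.β - 2)) x := by
  have hγ : 0 < l * R.A k := mul_pos hl (R.A_pos k)
  have hδ := (palasekTowerBreakdown_coreRadiusSq_pos R k hl hs₀ ht.le).ne'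
  rw [RadialEddy.strainedEddy_gaussian_eq hγ.ne' one_pos hs₀ _ ht hδ x,
    ← palasekTowerBreakdown_effectiveStrainFactor R k hl hs₀ ht.le]

/-- **The level-0 polytope at the readout instant of a strained Gaussian child** (wide rates,
`Schedule.Rigid`, `ν = 1`): if after the run-up `t ≥ 0` the child — the Burgers child core with
`λ_eff` — meets the velocity floor `S.c₁Y₁` by its own swirl, does not overshoot `S.c₂Y₁` anywhere and
meets the strain floor `S.c₁A₁` by its own gradient at an axis point, then
`13.46 < C√λ_eff < 25.12` and `0.33 < λ_eff` (`_polytope_zero` read with `λ ↦ λ_eff`). -/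
theorem palasekTowerBreakdown_gaussianChild_polytope_zero (S : Schedule TowerRates.wide)
    (hS : S.Rigid) {C l s₀ t : ℝ} (hC : 0 ≤ C) (hl : 0 < l) (hs₀ : 0 < s₀) (ht : 0 ≤ t)
    (hfloor : ∃ x : EuclideanSpace ℝ (Fin 3), S.c₁ * TowerRates.wide.Y 1 ≤
      ‖burgersVortexSwirl (l / (1 + (s₀ * (l * TowerRates.wide.A 0) - 1) *
          exp (-(l * TowerRates.wide.A 0 * t))) * TowerRates.wide.A 0) 1
        (C * TowerRates.wide.N 1 ^ (TowerRates.wide.β - 2)) x‖)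
    (hceil : ∀ x : EuclideanSpace ℝ (Fin 3),
      ‖burgersVortexSwirl (l / (1 + (s₀ * (l * TowerRates.wide.A 0) - 1) *
          exp (-(l * TowerRates.wide.A 0 * t))) * TowerRates.wide.A 0) 1
        (C * TowerRates.wide.N 1 ^ (TowerRates.wide.β - 2)) x‖ ≤ S.c₂ * TowerRates.wide.Y 1)
    {x₀ : EuclideanSpace ℝ (Fin 3)} (hx0 : x₀ 0 = 0) (hx1 : x₀ 1 = 0)
    (haxis : S.c₁ * TowerRates.wide.A 1 ≤
      ‖fderiv ℝ (burgersVortexSwirl (l / (1 + (s₀ * (l * TowerRates.wide.A 0) - 1) *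
          exp (-(l * TowerRates.wide.A 0 * t))) * TowerRates.wide.A 0) 1
        (C * TowerRates.wide.N 1 ^ (TowerRates.wide.β - 2))) x₀‖) :
    (13.46 < C * Real.sqrt (l / (1 + (s₀ * (l * TowerRates.wide.A 0) - 1) *
          exp (-(l * TowerRates.wide.A 0 * t)))) ∧
        C * Real.sqrt (l / (1 + (s₀ * (l * TowerRates.wide.A 0) - 1) *
          exp (-(l * TowerRates.wide.A 0 * t)))) < 25.12) ∧
      0.33 < l / (1 + (s₀ * (l * TowerRates.wide.A 0) - 1) * exp (-(l * TowerRates.wide.A 0 * t))) := by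
  have hle := palasekTowerBreakdown_effectiveStrainFactor_pos TowerRates.wide 0 hl hs₀ ht
  obtain ⟨h1, -, h3, -⟩ :=
    palasekTowerBreakdown_burgers_polytope_zero S hS hC hle hfloor hceil hx0 hx1 haxis
  exact ⟨h1, h3⟩

/-! ## §2 The budget in register units -/

/-- **THE COMPACTION BUDGET, register form** (`ν = 1`, host strain `λA_k`, tolerance `ρ > 1`, seed
fatter than the tolerated core: `ρ < s₀λA_k`): after a run-up of duration `t` the child core has
compacted to within `ρ` Burgers areas, `δ(t)² ≤ ρ/(λA_k)` — equivalently `λ_eff ≥ λ/ρ` — if and only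
if the run-up delivered `λA_k t ≥ log((s₀λA_k − 1)/(ρ − 1))` host strain-times. -/
theorem palasekTowerBreakdown_compaction_budget_iff (R : TowerRates) (k : ℕ) {l s₀ ρ : ℝ}
    (hl : 0 < l) {_hs₀ : 0 < s₀} (hρ : 1 < ρ) (hfat : ρ < s₀ * (l * R.A k)) (t : ℝ) :
    RadialEddy.strainedCoreRadiusSq (l * R.A k) 1 s₀ t ≤ ρ * (1 / (l * R.A k)) ↔
      Real.log ((s₀ * (l * R.A k) - 1) / (ρ - 1)) ≤ l * R.A k * t := by
  have hγ : 0 < l * R.A k := mul_pos hl (R.A_pos k)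
  have hρs : ρ * (1 / (l * R.A k)) < s₀ := by
    rw [← div_eq_mul_one_div, div_lt_iff₀ hγ]; exact hfat
  have h := RadialEddy.strainedCoreRadiusSq_le_iff hγ one_pos hρ hρs t
  rw [h, show s₀ / (1 / (l * R.A k)) = s₀ * (l * R.A k) by field_simp]

/-- **The run-up in host strain-times, window units** (wide rates, `Schedule.Rigid`): a run-up
occupying the fraction `θ ≥ 0` of the rigid window `0 → 1` in the host strain `λA₀`, `λ ≥ 0`, delivers
between `61.72·λθ` and `61.73·λθ` host strain-times (`(τ₁ − τ₀)A₀ = (253/25) log N₁`,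
`Schedule.Rigid.window_zero_strain_bounds`). -/
theorem palasekTowerBreakdown_compaction_budget_window (S : Schedule TowerRates.wide)
    (hS : S.Rigid) {l θ : ℝ} (hl : 0 ≤ l) (hθ : 0 ≤ θ) :
    61.72 * (l * θ) ≤ l * TowerRates.wide.A 0 * (θ * (S.τ 1 - S.τ 0)) ∧
      l * TowerRates.wide.A 0 * (θ * (S.τ 1 - S.τ 0)) ≤ 61.73 * (l * θ) := by
  obtain ⟨h1, h2⟩ := hS.window_zero_strain_bounds
  have hlθ : 0 ≤ l * θ := mul_nonneg hl hθ
  have e : l * TowerRates.wide.A 0 * (θ * (S.τ 1 - S.τ 0)) =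
      (S.τ 1 - S.τ 0) * TowerRates.wide.A 0 * (l * θ) := by ring
  rw [e]
  exact ⟨by nlinarith, by nlinarith⟩

/-- **Sufficient budget in window units**: if `log((s₀λA₀ − 1)/(ρ − 1)) ≤ 61.72·λθ` then a run-up
over the fraction `θ` of the rigid window `0 → 1` compacts the child core to within `ρ` Burgers areas
(so that `λ_eff ≥ λ/ρ` at `τ₁`). -/
theorem palasekTowerBreakdown_compaction_budget_sufficient (S : Schedule TowerRates.wide)
    (hS : S.Rigid) {l s₀ ρ θ : ℝ} (hl : 0 < l) (hs₀ : 0 < s₀) (hρ : 1 < ρ)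
    (hfat : ρ < s₀ * (l * TowerRates.wide.A 0)) (hθ : 0 ≤ θ)
    (hB : Real.log ((s₀ * (l * TowerRates.wide.A 0) - 1) / (ρ - 1)) ≤ 61.72 * (l * θ)) :
    RadialEddy.strainedCoreRadiusSq (l * TowerRates.wide.A 0) 1 s₀ (θ * (S.τ 1 - S.τ 0)) ≤
      ρ * (1 / (l * TowerRates.wide.A 0)) := by
  rw [palasekTowerBreakdown_compaction_budget_iff TowerRates.wide 0 hl hρ hfat (_hs₀ := hs₀)]
  have hw := (palasekTowerBreakdown_compaction_budget_window S hS hl.le hθ).1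
  linarith

/-- **Necessary budget in window units**: if the run-up over the fraction `θ` of the rigid window
`0 → 1` compacts the child core to within `ρ` Burgers areas, then `log((s₀λA₀ − 1)/(ρ − 1)) ≤ 61.73·λθ`.
-/
theorem palasekTowerBreakdown_compaction_budget_necessary (S : Schedule TowerRates.wide)
    (hS : S.Rigid) {l s₀ ρ θ : ℝ} (hl : 0 < l) (hs₀ : 0 < s₀) (hρ : 1 < ρ)
    (hfat : ρ < s₀ * (l * TowerRates.wide.A 0)) (hθ : 0 ≤ θ)
    (hc : RadialEddy.strainedCoreRadiusSq (l * TowerRates.wide.A 0) 1 s₀ (θ * (S.τ 1 - S.τ 0)) ≤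
      ρ * (1 / (l * TowerRates.wide.A 0))) :
    Real.log ((s₀ * (l * TowerRates.wide.A 0) - 1) / (ρ - 1)) ≤ 61.73 * (l * θ) := by
  rw [palasekTowerBreakdown_compaction_budget_iff TowerRates.wide 0 hl hρ hfat (_hs₀ := hs₀)] at hc
  have hw := (palasekTowerBreakdown_compaction_budget_window S hS hl.le hθ).2
  linarith

/-- **The seeded λ-floor**: whenever the effective strain factor of the strained Gaussian child must
exceed a floor `λ_min > 0` at the readout instant (e.g. `0.33`, `_gaussianChild_polytope_zero`), the
HOST strain factor must exceed it by the un-compacted excess of the seed: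
`λ_min · (1 + (s₀λA_k − 1)e^{−λA_k t}) < λ` (for a fat seed `s₀λA_k ≥ 1`). -/
theorem palasekTowerBreakdown_lambda_floor_seeded (R : TowerRates) (k : ℕ) {l s₀ t lmin : ℝ}
    (hfat : 1 ≤ s₀ * (l * R.A k))
    (hfloor : lmin < l / (1 + (s₀ * (l * R.A k) - 1) * exp (-(l * R.A k * t)))) :
    lmin * (1 + (s₀ * (l * R.A k) - 1) * exp (-(l * R.A k * t))) < l := by
  have he := exp_pos (-(l * R.A k * t))
  have hden : 0 < 1 + (s₀ * (l * R.A k) - 1) * exp (-(l * R.A k * t)) := by nlinarith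
  rwa [lt_div_iff₀ hden] at hfloor

/-! ## §3 The anchor-limited seed (the register's anchor `‖u(τ₀)‖ ≤ c₁Y₀` read on the Gaussian seed)

At `τ₀` every speed of a registered stage is at most `c₁Y₀` (`Stage.norm_τ_zero_le`). Read on the
MODEL seed — the Gaussian `(C N₁^{β−2}) · H(s₀, ·)`, whose swirl at `ν = 1` is the Burgers swirl of
strain `1/s₀` (`RadialEddy.vorticityToSwirl_rayProfile_gaussian'`), with some point of speed
`≥ 0.632 · Γ/(4π√s₀)` (`exists_norm_burgersVortexSwirl_ge`) — the anchor bounds the seed FROM BELOW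
in Burgers areas of the host strain: **`r₀ = s₀λA₀ ≥ 0.0186 · (C√λ)²`** (`_seed_anchor_zero`;
convention-free: `s₀` and `δ_B² = 1/(λA₀)` are both parameters of `e^{−r²/4s}`). Hence the minimal
compaction budget is itself bounded below by name (`_compaction_budget_anchor_zero`):
`λA₀t ≥ log((0.0186(C√λ)² − 1)/(ρ − 1))` whenever the tolerated ratio `ρ` is below `0.0186(C√λ)²`.
(Reading, E–C: along the certified ceiling `C√λ ≈ 25` this is `r₀ ≥ 11.6`; the table of STATUS l.3420
used `(δ_s/δ_B)² ≈ 47`, a `1/e`-radius for the seed against `(ν/γ)^{1/2}` for the Burgers core — the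
same seed in one convention is `≈ 11`, and the minimal budgets `log((r₀ − 1)/(ρ − 1))` drop by
`≈ log 4`.) -/

/-- `Y₀² = A₀ · N₀^{β−2}` (`N^{2(β−1)} = N^β · N^{β−2}`). -/
theorem palasekTowerBreakdown_Y_sq_eq (R : TowerRates) (k : ℕ) :
    R.Y k ^ 2 = R.A k * R.N k ^ (R.β - 2) := by
  have hN := R.N_pos k
  rw [TowerRates.Y, TowerRates.A, ← Real.rpow_natCast, ← Real.rpow_mul hN.le, ← Real.rpow_add hN]
  congr 1
  push_cast
  ring

/-- The level-0 Reynolds number `N₀^{β−2} = 256^{3/10} = 2^{12/5} < 5.279` (`5.279⁵ > 4096`). -/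
theorem wide_N_zero_rpow_sub_two_lt : TowerRates.wide.N 0 ^ (TowerRates.wide.β - 2) < 5.279 := by
  rw [TowerRates.wide_N_rpow_sub_two_eq_two_rpow, pow_zero, mul_one,
    show (8 : ℝ) * (3 / 10) = 12 / 5 by norm_num]
  exact TowerRates.two_rpow_lt_of_pow_lt (by norm_num) (a := 12) (m := 1) (r := 5) (by norm_num)
    (by norm_num)

/-- **THE ANCHOR-LIMITED SEED** (wide rates, `Schedule.Rigid`, `ν = 1`): if the seed's swirl — the
Burgers swirl of strain `1/s₀` and circulation `C N₁^{β−2}` — obeys the anchor `‖·‖ ≤ S.c₁ · Y₀`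
everywhere, then the seed holds at least `0.0186 · C²λ` Burgers areas of the host strain `λA₀`:
`0.0186 · C²λ ≤ s₀λA₀` (`(79/125)² · 6.233²/(16π² · 5.279) > 0.0186`). -/
theorem palasekTowerBreakdown_seed_anchor_zero (S : Schedule TowerRates.wide) (hS : S.Rigid)
    {C l s₀ : ℝ} (hC : 0 ≤ C) (hl : 0 < l) (hs₀ : 0 < s₀)
    (hanchor : ∀ x : EuclideanSpace ℝ (Fin 3),
      ‖burgersVortexSwirl (1 / s₀) 1 (C * TowerRates.wide.N 1 ^ (TowerRates.wide.β - 2)) x‖ ≤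
        S.c₁ * TowerRates.wide.Y 0) :
    0.0186 * (C ^ 2 * l) ≤ s₀ * (l * TowerRates.wide.A 0) := by
  set G := TowerRates.wide.N 1 ^ (TowerRates.wide.β - 2) with hG
  set Q := TowerRates.wide.N 0 ^ (TowerRates.wide.β - 2) with hQ
  have hG0 : 0 ≤ G := Real.rpow_nonneg (TowerRates.wide.N_pos 1).le _
  have hQ0 : 0 < Q := Real.rpow_pos_of_pos (TowerRates.wide.N_pos 0) _
  obtain ⟨hG1, -⟩ := TowerRates.wide_N_one_rpow_bounds
  have hQ1 := wide_N_zero_rpow_sub_two_lt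
  have hA := TowerRates.wide.A_pos 0
  have hpi := Real.pi_pos
  have hpi2 := Real.pi_lt_d6
  -- the anchor on the seed: `(79/125) · CG/√s₀ ≤ 4π Y₀`
  obtain ⟨x, hx⟩ := exists_norm_burgersVortexSwirl_ge (one_div_pos.2 hs₀) one_pos (C * G)
  have h1 := hx.trans (hanchor x)
  rw [hS.c₁_eq, one_mul, div_one, abs_of_nonneg (mul_nonneg hC hG0), Real.sqrt_div' _ hs₀.le,
    Real.sqrt_one] at h1
  have hs := Real.sqrt_pos.2 hs₀
  have hss : Real.sqrt s₀ ^ 2 = s₀ := Real.sq_sqrt hs₀.le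
  -- clear denominators: `(79/125) C G ≤ 4π Y₀ √s₀`
  have h2 : 79 / 125 * (C * G) ≤ 4 * Real.pi * TowerRates.wide.Y 0 * Real.sqrt s₀ := by
    have e : 79 / 125 * (C * G * (1 / Real.sqrt s₀) / (4 * Real.pi)) =
        79 / 125 * (C * G) / (4 * Real.pi * Real.sqrt s₀) := by
      field_simp
    rw [e, div_le_iff₀ (by positivity)] at h1
    calc 79 / 125 * (C * G) ≤ TowerRates.wide.Y 0 * (4 * Real.pi * Real.sqrt s₀) := h1
      _ = 4 * Real.pi * TowerRates.wide.Y 0 * Real.sqrt s₀ := by ring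
  -- square and use `Y₀² = A₀ Q`
  have h3 : (79 / 125 * (C * G)) ^ 2 ≤ (4 * Real.pi * TowerRates.wide.Y 0 * Real.sqrt s₀) ^ 2 :=
    pow_le_pow_left₀ (by positivity) h2 2
  rw [mul_pow, mul_pow, mul_pow, mul_pow, hss, palasekTowerBreakdown_Y_sq_eq, ← hQ] at h3
  -- numerics: `0.0186 · 16π² Q ≤ (79/125)² G²`
  have hCl : 0 ≤ C ^ 2 := sq_nonneg C
  have hnum : 0.0186 * ((4 * Real.pi) ^ 2 * Q) ≤ (79 / 125 : ℝ) ^ 2 * 6.233 ^ 2 := by nlinarith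
  have hG2 : (6.233 : ℝ) ^ 2 ≤ G ^ 2 := pow_le_pow_left₀ (by norm_num) hG1.le 2
  have key : 0.0186 * C ^ 2 * ((4 * Real.pi) ^ 2 * Q) ≤ (4 * Real.pi) ^ 2 * Q * (TowerRates.wide.A 0 * s₀) := by
    calc 0.0186 * C ^ 2 * ((4 * Real.pi) ^ 2 * Q)
        = C ^ 2 * (0.0186 * ((4 * Real.pi) ^ 2 * Q)) := by ring
      _ ≤ C ^ 2 * ((79 / 125 : ℝ) ^ 2 * G ^ 2) := by
          refine mul_le_mul_of_nonneg_left (hnum.trans ?_) hCl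
          exact mul_le_mul_of_nonneg_left hG2 (by positivity)
      _ = (79 / 125) ^ 2 * (C ^ 2 * G ^ 2) := by ring
      _ ≤ (4 * Real.pi) ^ 2 * (TowerRates.wide.A 0 * Q) * s₀ := h3
      _ = (4 * Real.pi) ^ 2 * Q * (TowerRates.wide.A 0 * s₀) := by ring
  have hpos : 0 < (4 * Real.pi) ^ 2 * Q := by positivity
  have h4 : 0.0186 * C ^ 2 ≤ TowerRates.wide.A 0 * s₀ := le_of_mul_le_mul_right (by linarith) hpos
  nlinarith [mul_le_mul_of_nonneg_left h4 hl.le]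

/-- **THE MINIMAL COMPACTION BUDGET IS BOUNDED BELOW BY NAME** (wide rates, `Schedule.Rigid`,
`ν = 1`): if the seed obeys the anchor `S.c₁Y₀` on its swirl and the run-up of duration `t` compacts
the child core to within `ρ` Burgers areas (`1 < ρ < 0.0186·C²λ`), then
`λA₀t ≥ log((0.0186·C²λ − 1)/(ρ − 1))`. -/
theorem palasekTowerBreakdown_compaction_budget_anchor_zero (S : Schedule TowerRates.wide)
    (hS : S.Rigid) {C l s₀ ρ t : ℝ} (hC : 0 ≤ C) (hl : 0 < l) (hs₀ : 0 < s₀) (hρ : 1 < ρ)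
    (hρC : ρ < 0.0186 * (C ^ 2 * l))
    (hanchor : ∀ x : EuclideanSpace ℝ (Fin 3),
      ‖burgersVortexSwirl (1 / s₀) 1 (C * TowerRates.wide.N 1 ^ (TowerRates.wide.β - 2)) x‖ ≤
        S.c₁ * TowerRates.wide.Y 0)
    (hcomp : RadialEddy.strainedCoreRadiusSq (l * TowerRates.wide.A 0) 1 s₀ t ≤
      ρ * (1 / (l * TowerRates.wide.A 0))) :
    Real.log ((0.0186 * (C ^ 2 * l) - 1) / (ρ - 1)) ≤ l * TowerRates.wide.A 0 * t := by
  have hr := palasekTowerBreakdown_seed_anchor_zero S hS hC hl hs₀ hanchor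
  have hfat : ρ < s₀ * (l * TowerRates.wide.A 0) := hρC.trans_le hr
  have hB := (palasekTowerBreakdown_compaction_budget_iff TowerRates.wide 0 hl hρ hfat
    (_hs₀ := hs₀) t).1 hcomp
  refine le_trans (Real.log_le_log (div_pos (by linarith) (by linarith)) ?_) hB
  exact div_le_div_of_nonneg_right (by linarith) (by linarith)

/-- **The same in window units**: under the anchor, compaction to within `ρ` during a run-up
occupying the fraction `θ ≥ 0` of the rigid window `0 → 1` requires
`log((0.0186·C²λ − 1)/(ρ − 1)) ≤ 61.73·λθ`. -/
theorem palasekTowerBreakdown_compaction_budget_anchor_window (S : Schedule TowerRates.wide)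
    (hS : S.Rigid) {C l s₀ ρ θ : ℝ} (hC : 0 ≤ C) (hl : 0 < l) (hs₀ : 0 < s₀) (hρ : 1 < ρ)
    (hρC : ρ < 0.0186 * (C ^ 2 * l)) (hθ : 0 ≤ θ)
    (hanchor : ∀ x : EuclideanSpace ℝ (Fin 3),
      ‖burgersVortexSwirl (1 / s₀) 1 (C * TowerRates.wide.N 1 ^ (TowerRates.wide.β - 2)) x‖ ≤
        S.c₁ * TowerRates.wide.Y 0)
    (hcomp : RadialEddy.strainedCoreRadiusSq (l * TowerRates.wide.A 0) 1 s₀ (θ * (S.τ 1 - S.τ 0)) ≤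
      ρ * (1 / (l * TowerRates.wide.A 0))) :
    Real.log ((0.0186 * (C ^ 2 * l) - 1) / (ρ - 1)) ≤ 61.73 * (l * θ) := by
  have h := palasekTowerBreakdown_compaction_budget_anchor_zero S hS hC hl hs₀ hρ hρC hanchor hcomp
  have hw := (palasekTowerBreakdown_compaction_budget_window S hS hl.le hθ).2
  linarith

end Summit.NavierStokesRegularity.FluidComputer.PalasekTowerClayBridge
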